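import Mathlib
import Summits.NavierStokesRegularity.NavierStokesRegularity.Theorems.FilamentSkeletonRssKelvinGateFreeResolventSmooth
import Summits.NavierStokesRegularity.NavierStokesRegularity.Theorems.FilamentSkeletonRssKelvinGateRotation

/-!
# Route `FilamentSkeletonRss` · crux `TransverseReductionRJ` (stmt-NavierStokesRegularity-21221) — line `kelvin_gate`,
# stub S2′ `EventualKelvinGate`: the FREE GATE, velocity part — `𝓛_(α,0) W = F` with `W ∈ X` for `F ∈ Y`

Helper file (theorems only, `--supports stmt-NavierStokesRegularity-21221 --as helper`).  HONEST FRAMING: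
analysis bookkeeping for a HYPOTHETICAL filament-type rotating-self-similar blow-up route; nothing here
bears on Navier–Stokes regularity; no stub is proved here.

Main result (`free_resolvent`, the existence half of the free gate's velocity part; the uniqueness half
is `…KelvinGateFreeKernel` / `…KelvinGateMaxPrinciple` of the line):

  there is an ABSOLUTE constant `C` such that for every rate `α` and every `F` in the line's Y-scale,
  `YBound F R`, the field `W(y) = ∫₀^∞ (e^{-s/2} R_{−αs}) (e^{(1 − e^{-s})Δ} F)(e^{-s/2} R_{αs} y) ds`
  satisfies `XBound W (C R)` and solves `𝓛_(α,0) W = F` pointwise, where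
  `𝓛_(α,0) W = α (e₃ × W − DW[e₃ × y]) + ½ W + ½ DW[y] − ΔW` is `Theorems.KelvinGate.lerayLin α 0`.

Proof: `∂_s W_s = −𝓛 W_s` (`hasDerivAt_freeSlice`), `W_s → F` at `s = 0⁺`, `W_s → 0` at `∞`, so the fundamental
theorem of calculus on `(0, ∞)` gives `∫₀^∞ 𝓛 W_s ds = F`; and `𝓛` passes under the integral sign by the
dominated-differentiation results of `…KelvinGateFreeResolventSmooth` (`integral_lerayLin_freeSlice`,
`lerayLin_freeResolvent`).  The constant is `C = 8 C_G + 5 · 2^{3/2} C_G ∫₀^∞ s^{-1/2} e^{-s/2} ds` with `C_G` the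
quadratic-weight caloric constant of `…KelvinGateHeatWeight` — independent of `α` (the rotating frame is isometric).
What this is NOT: the free GATE also needs a pressure and incompressible output for non-solenoidal `F`
(Leray projection in Hölder classes) — not in this file.
-/

set_option linter.dupNamespace false

noncomputable section

namespace Summit.NavierStokesRegularity.NavierStokesRegularity.Theorems.KelvinGate

open Set Function Filter Topology InnerProductSpace MeasureTheory Real Metric
open Literature.Analysis.FluidPDE Literature.Analysis.UnboundedOperators
open scoped Laplacian RealInnerProductSpace ContDiff Topology ENNReal BigOperators

section Equation

variable {F : EuclideanSpace ℝ (Fin 3) → EuclideanSpace ℝ (Fin 3)} {C₀ C₁ : ℝ}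

/-! ## Integrability of `s ↦ 𝓛 W_s (y)` -/

/-- The linearised operator at the trivial base, expanded: for any field `V` and point `y`,
`𝓛_(α,0) V (y) = α (J V(y) − DV(y)[J y]) + ½ V(y) + ½ DV(y)[y] − Σ_i D²V(y)[e_i, e_i]` (`J = e₃ × ·`). -/
theorem lerayLin_zero_base_eq (α : ℝ) (V : EuclideanSpace ℝ (Fin 3) → EuclideanSpace ℝ (Fin 3)) (y : EuclideanSpace ℝ (Fin 3)) :
    lerayLin α (fun _ => 0) V y =
      α • (rotGenL (V y) - fderiv ℝ V y (rotGenL y)) + (1/2:ℝ) • V y + (1/2:ℝ) • fderiv ℝ V y y -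
        ∑ i : Fin 3, fderiv ℝ (fderiv ℝ V) y (EuclideanSpace.basisFun (Fin 3) ℝ i) (EuclideanSpace.basisFun (Fin 3) ℝ i) := by
  unfold lerayLin
  rw [cross_single_two_eq_rotGen, cross_single_two_eq_rotGen, laplacian_eq_sum_fderiv_fderiv V]
  simp only [fderiv_fun_const, Pi.zero_apply, zero_apply, map_zero, add_zero, rotGenL_apply]

/-- `s ↦ D²W_s(y)[v][w]` is integrable on `(0, ∞)` for fixed vectors `v, w`. -/
theorem integrableOn_fderiv_fderiv_freeSlice_apply (hF : ContDiff ℝ 1 F) (h0 : ∀ z, ‖F z‖ ≤ C₀)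
    (h1 : ∀ z, ‖fderiv ℝ F z‖ ≤ C₁) (α : ℝ) (y v w : EuclideanSpace ℝ (Fin 3)) :
    IntegrableOn (fun s : ℝ => fderiv ℝ (fun z => fderiv ℝ (fun z => (Real.exp (-(s / 2)) • rotZL (-(α * s)))
        (heatExtension F (1 - Real.exp (-s)) ((Real.exp (-(s / 2)) • rotZL (α * s)) z))) z) y v w) (Ioi 0) := by
  have hFc := hF.continuous
  have hb : IntegrableOn (fun s : ℝ => (2 : ℝ) ^ ((3 : ℝ) / 2) * C₁ * (s ^ (-(1 / 2 : ℝ)) * exp (-s)) * ‖v‖ * ‖w‖) (Ioi 0) := by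
    have h : IntegrableOn (fun s : ℝ => s ^ (-(1 / 2 : ℝ)) * exp (-((1:ℝ) * s))) (Ioi 0) :=
      integrableOn_rpow_neg_half_mul_exp_neg one_pos
    have h' : IntegrableOn (fun s : ℝ => s ^ (-(1 / 2 : ℝ)) * exp (-s)) (Ioi 0) :=
      h.congr_fun (fun s _ => by simp only [one_mul]) measurableSet_Ioi
    exact ((h'.const_mul _).mul_const _).mul_const _
  refine Integrable.mono' hb ?_ ?_
  · exact (((continuousOn_fderiv_fderiv_freeSlice hFc h0 α y).clm_apply continuousOn_const).clm_apply
      continuousOn_const).aestronglyMeasurable measurableSet_Ioi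
  · refine (ae_restrict_iff' measurableSet_Ioi).2 (Eventually.of_forall fun s hs => ?_)
    have h := norm_fderiv_fderiv_freeSlice_le_rpow hF h0 h1 α hs y
    calc _ ≤ ‖fderiv ℝ (fun z => fderiv ℝ (fun z => (Real.exp (-(s / 2)) • rotZL (-(α * s)))
            (heatExtension F (1 - Real.exp (-s)) ((Real.exp (-(s / 2)) • rotZL (α * s)) z))) z) y v‖ * ‖w‖ :=
          ContinuousLinearMap.le_opNorm _ _
      _ ≤ ‖fderiv ℝ (fun z => fderiv ℝ (fun z => (Real.exp (-(s / 2)) • rotZL (-(α * s)))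
            (heatExtension F (1 - Real.exp (-s)) ((Real.exp (-(s / 2)) • rotZL (α * s)) z))) z) y‖ * ‖v‖ * ‖w‖ :=
          mul_le_mul_of_nonneg_right (ContinuousLinearMap.le_opNorm _ _) (norm_nonneg _)
      _ ≤ _ := by gcongr

/-- `s ↦ 𝓛_(α,0) W_s (y)` is integrable on `(0, ∞)`. -/
theorem integrableOn_lerayLin_freeSlice (hF : ContDiff ℝ 1 F) (h0 : ∀ z, ‖F z‖ ≤ C₀) (h1 : ∀ z, ‖fderiv ℝ F z‖ ≤ C₁)
    (α : ℝ) (y : EuclideanSpace ℝ (Fin 3)) :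
    IntegrableOn (fun s : ℝ => lerayLin α (fun _ => 0) (fun z => (Real.exp (-(s / 2)) • rotZL (-(α * s)))
        (heatExtension F (1 - Real.exp (-s)) ((Real.exp (-(s / 2)) • rotZL (α * s)) z))) y) (Ioi 0) := by
  have hFc := hF.continuous
  have hV := integrableOn_freeSlice hFc h0 α y
  have hD := integrableOn_fderiv_freeSlice hF h0 h1 α y
  have hJV : IntegrableOn (fun s : ℝ => rotGenL ((Real.exp (-(s / 2)) • rotZL (-(α * s)))
      (heatExtension F (1 - Real.exp (-s)) ((Real.exp (-(s / 2)) • rotZL (α * s)) y)))) (Ioi 0) :=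
    ContinuousLinearMap.integrable_comp rotGenL hV
  have hDv : ∀ v : EuclideanSpace ℝ (Fin 3), IntegrableOn (fun s : ℝ => fderiv ℝ (fun z => (Real.exp (-(s / 2)) • rotZL (-(α * s)))
      (heatExtension F (1 - Real.exp (-s)) ((Real.exp (-(s / 2)) • rotZL (α * s)) z))) y v) (Ioi 0) := fun v =>
    (ContinuousLinearMap.apply ℝ (EuclideanSpace ℝ (Fin 3)) v).integrable_comp hD
  have hΔ : IntegrableOn (fun s : ℝ => ∑ i : Fin 3, fderiv ℝ (fderiv ℝ (fun z => (Real.exp (-(s / 2)) • rotZL (-(α * s)))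
      (heatExtension F (1 - Real.exp (-s)) ((Real.exp (-(s / 2)) • rotZL (α * s)) z)))) y
        (EuclideanSpace.basisFun (Fin 3) ℝ i) (EuclideanSpace.basisFun (Fin 3) ℝ i)) (Ioi 0) :=
    integrable_finsetSum _ fun i _ => integrableOn_fderiv_fderiv_freeSlice_apply hF h0 h1 α y _ _
  have h := ((((hJV.sub (hDv (rotGenL y))).smul α).add (hV.smul (1/2:ℝ))).add ((hDv y).smul (1/2:ℝ))).sub hΔ
  refine h.congr ((ae_restrict_iff' measurableSet_Ioi).2 (Eventually.of_forall fun s _ => ?_))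
  simp only [lerayLin_zero_base_eq, Pi.add_apply, Pi.sub_apply, Pi.smul_apply]

/-! ## `∫₀^∞ 𝓛 W_s (y) ds = F(y)` -/

/-- **`∫₀^∞ 𝓛_(α,0) W_s (y) ds = F(y)`** for `F ∈ C¹` bounded with bounded derivative: the fundamental theorem of
calculus on `(0, ∞)` for `s ↦ W_s(y)` (derivative `−𝓛 W_s(y)`, boundary values `F(y)` at `0⁺` and `0` at `∞`). -/
theorem integral_lerayLin_freeSlice (hF : ContDiff ℝ 1 F) (h0 : ∀ z, ‖F z‖ ≤ C₀) (h1 : ∀ z, ‖fderiv ℝ F z‖ ≤ C₁)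
    (α : ℝ) (y : EuclideanSpace ℝ (Fin 3)) :
    ∫ s in Ioi (0:ℝ), lerayLin α (fun _ => 0) (fun z => (Real.exp (-(s / 2)) • rotZL (-(α * s)))
        (heatExtension F (1 - Real.exp (-s)) ((Real.exp (-(s / 2)) • rotZL (α * s)) z))) y = F y := by
  have hFc := hF.continuous
  -- the slice at `y` as a function of `s`, with the value `F y` put in at `s = 0`
  set f : ℝ → EuclideanSpace ℝ (Fin 3) := fun s => (Real.exp (-(s / 2)) • rotZL (-(α * s)))
      (heatExtension F (1 - Real.exp (-s)) ((Real.exp (-(s / 2)) • rotZL (α * s)) y)) with hf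
  set g : ℝ → EuclideanSpace ℝ (Fin 3) := Function.update f 0 (F y) with hg
  have hgf : ∀ {s : ℝ}, 0 < s → g s = f s := fun hs => by rw [hg, Function.update_of_ne (ne_of_gt hs)]
  have hg0 : g 0 = F y := by rw [hg, Function.update_self]
  -- continuity at `0⁺`
  have hcont : ContinuousWithinAt g (Ici 0) 0 := by
    rw [← continuousWithinAt_Ioi_iff_Ici, ContinuousWithinAt, hg0]
    refine (tendsto_freeSlice_zero hFc h0 α y).congr' ?_
    filter_upwards [self_mem_nhdsWithin] with s hs
    exact (hgf hs).symm
  -- derivative on `(0, ∞)`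
  have hderiv : ∀ s ∈ Ioi (0:ℝ), HasDerivAt g (-(lerayLin α (fun _ => 0) (fun z => (Real.exp (-(s / 2)) • rotZL (-(α * s)))
        (heatExtension F (1 - Real.exp (-s)) ((Real.exp (-(s / 2)) • rotZL (α * s)) z))) y)) s := by
    intro s hs
    refine (hasDerivAt_freeSlice hFc h0 α hs y).congr_of_eventuallyEq ?_
    filter_upwards [eventually_ne_nhds (ne_of_gt hs)] with t ht
    rw [hg, Function.update_of_ne ht]
  -- decay at `∞`
  have hlim : Tendsto g atTop (𝓝 0) := by
    refine (tendsto_freeSlice_atTop h0 α y).congr' ?_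
    filter_upwards [eventually_gt_atTop (0:ℝ)] with s hs
    exact (hgf hs).symm
  have hint := (integrableOn_lerayLin_freeSlice hF h0 h1 α y).neg
  have hFTC := integral_Ioi_of_hasDerivAt_of_tendsto hcont hderiv hint hlim
  rw [integral_neg, hg0, zero_sub, neg_inj] at hFTC
  exact hFTC

/-! ## `𝓛` passes under the integral sign -/

/-- **`𝓛_(α,0) (∫₀^∞ W_s ds)(y) = ∫₀^∞ 𝓛_(α,0) W_s (y) ds`** (the value, the derivative and the second derivative of
the resolvent are the integrals of those of the slices, and `𝓛_(α,0)` is linear in them). -/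
theorem lerayLin_freeResolvent (hF : ContDiff ℝ 1 F) (h0 : ∀ z, ‖F z‖ ≤ C₀) (h1 : ∀ z, ‖fderiv ℝ F z‖ ≤ C₁)
    (α : ℝ) (y : EuclideanSpace ℝ (Fin 3)) :
    lerayLin α (fun _ => 0) (fun y => ∫ s in Ioi (0:ℝ), (Real.exp (-(s / 2)) • rotZL (-(α * s)))
        (heatExtension F (1 - Real.exp (-s)) ((Real.exp (-(s / 2)) • rotZL (α * s)) y))) y =
      ∫ s in Ioi (0:ℝ), lerayLin α (fun _ => 0) (fun z => (Real.exp (-(s / 2)) • rotZL (-(α * s)))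
        (heatExtension F (1 - Real.exp (-s)) ((Real.exp (-(s / 2)) • rotZL (α * s)) z))) y := by
  have hFc := hF.continuous
  -- the derivatives of the resolvent
  have hD1 : fderiv ℝ (fun y => ∫ s in Ioi (0:ℝ), (Real.exp (-(s / 2)) • rotZL (-(α * s)))
        (heatExtension F (1 - Real.exp (-s)) ((Real.exp (-(s / 2)) • rotZL (α * s)) y))) =
      fun y => ∫ s in Ioi (0:ℝ), fderiv ℝ (fun z => (Real.exp (-(s / 2)) • rotZL (-(α * s)))
        (heatExtension F (1 - Real.exp (-s)) ((Real.exp (-(s / 2)) • rotZL (α * s)) z))) y :=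
    funext fun y => (hasFDerivAt_freeResolvent hF h0 h1 α y).fderiv
  have hD2 : fderiv ℝ (fderiv ℝ (fun y => ∫ s in Ioi (0:ℝ), (Real.exp (-(s / 2)) • rotZL (-(α * s)))
        (heatExtension F (1 - Real.exp (-s)) ((Real.exp (-(s / 2)) • rotZL (α * s)) y)))) y =
      ∫ s in Ioi (0:ℝ), fderiv ℝ (fun z => fderiv ℝ (fun z => (Real.exp (-(s / 2)) • rotZL (-(α * s)))
        (heatExtension F (1 - Real.exp (-s)) ((Real.exp (-(s / 2)) • rotZL (α * s)) z))) z) y := by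
    rw [hD1]
    exact (hasFDerivAt_fderiv_freeResolvent hF h0 h1 α y).fderiv
  -- integrability of the pieces
  have hV := integrableOn_freeSlice hFc h0 α y
  have hD := integrableOn_fderiv_freeSlice hF h0 h1 α y
  have hJV : IntegrableOn (fun s : ℝ => rotGenL ((Real.exp (-(s / 2)) • rotZL (-(α * s)))
      (heatExtension F (1 - Real.exp (-s)) ((Real.exp (-(s / 2)) • rotZL (α * s)) y)))) (Ioi 0) :=
    ContinuousLinearMap.integrable_comp rotGenL hV
  have hDv : ∀ v : EuclideanSpace ℝ (Fin 3), IntegrableOn (fun s : ℝ => fderiv ℝ (fun z => (Real.exp (-(s / 2)) • rotZL (-(α * s)))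
      (heatExtension F (1 - Real.exp (-s)) ((Real.exp (-(s / 2)) • rotZL (α * s)) z))) y v) (Ioi 0) := fun v =>
    (ContinuousLinearMap.apply ℝ (EuclideanSpace ℝ (Fin 3)) v).integrable_comp hD
  have hD2i : ∀ i : Fin 3, IntegrableOn (fun s : ℝ => fderiv ℝ (fderiv ℝ (fun z => (Real.exp (-(s / 2)) • rotZL (-(α * s)))
      (heatExtension F (1 - Real.exp (-s)) ((Real.exp (-(s / 2)) • rotZL (α * s)) z)))) y
        (EuclideanSpace.basisFun (Fin 3) ℝ i) (EuclideanSpace.basisFun (Fin 3) ℝ i)) (Ioi 0) := fun i =>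
    integrableOn_fderiv_fderiv_freeSlice_apply hF h0 h1 α y _ _
  have hΔ := integrable_finsetSum (Finset.univ : Finset (Fin 3)) fun i _ => hD2i i
  -- the second derivative applied to `(e_i, e_i)` under the integral
  have hD2apply : ∀ i : Fin 3, fderiv ℝ (fderiv ℝ (fun y => ∫ s in Ioi (0:ℝ), (Real.exp (-(s / 2)) • rotZL (-(α * s)))
        (heatExtension F (1 - Real.exp (-s)) ((Real.exp (-(s / 2)) • rotZL (α * s)) y)))) y
        (EuclideanSpace.basisFun (Fin 3) ℝ i) (EuclideanSpace.basisFun (Fin 3) ℝ i) =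
      ∫ s in Ioi (0:ℝ), fderiv ℝ (fderiv ℝ (fun z => (Real.exp (-(s / 2)) • rotZL (-(α * s)))
        (heatExtension F (1 - Real.exp (-s)) ((Real.exp (-(s / 2)) • rotZL (α * s)) z)))) y
          (EuclideanSpace.basisFun (Fin 3) ℝ i) (EuclideanSpace.basisFun (Fin 3) ℝ i) := by
    intro i
    rw [hD2]
    -- integrability of `s ↦ D²W_s(y)` under the normed structure fixed by `integral_apply`
    have hb : IntegrableOn (fun s : ℝ => (2 : ℝ) ^ ((3 : ℝ) / 2) * C₁ * (s ^ (-(1 / 2 : ℝ)) * exp (-s))) (Ioi 0) := by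
      have h : IntegrableOn (fun s : ℝ => s ^ (-(1 / 2 : ℝ)) * exp (-((1:ℝ) * s))) (Ioi 0) :=
        integrableOn_rpow_neg_half_mul_exp_neg one_pos
      have h' : IntegrableOn (fun s : ℝ => s ^ (-(1 / 2 : ℝ)) * exp (-s)) (Ioi 0) :=
        h.congr_fun (fun s _ => by simp only [one_mul]) measurableSet_Ioi
      exact h'.const_mul _
    rw [ContinuousLinearMap.integral_apply ?hI2, ContinuousLinearMap.integral_apply ?hI1]
    case hI2 =>
      refine Integrable.mono' hb ?_ ?_
      · exact (continuousOn_fderiv_fderiv_freeSlice hFc h0 α y).aestronglyMeasurable measurableSet_Ioi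
      · exact (ae_restrict_iff' measurableSet_Ioi).2
          (Eventually.of_forall fun s hs => norm_fderiv_fderiv_freeSlice_le_rpow hF h0 h1 α hs y)
    case hI1 =>
      refine Integrable.mono' (hb.mul_const ‖EuclideanSpace.basisFun (Fin 3) ℝ i‖) ?_ ?_
      · exact ((continuousOn_fderiv_fderiv_freeSlice hFc h0 α y).clm_apply continuousOn_const).aestronglyMeasurable
          measurableSet_Ioi
      · refine (ae_restrict_iff' measurableSet_Ioi).2 (Eventually.of_forall fun s hs => ?_)
        exact (ContinuousLinearMap.le_opNorm _ _).trans (mul_le_mul_of_nonneg_right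
          (norm_fderiv_fderiv_freeSlice_le_rpow hF h0 h1 α hs y) (norm_nonneg _))
  -- assemble: the right-hand side, integrated term by term
  have hD1y : fderiv ℝ (fun y => ∫ s in Ioi (0:ℝ), (Real.exp (-(s / 2)) • rotZL (-(α * s)))
        (heatExtension F (1 - Real.exp (-s)) ((Real.exp (-(s / 2)) • rotZL (α * s)) y))) y =
      ∫ s in Ioi (0:ℝ), fderiv ℝ (fun z => (Real.exp (-(s / 2)) • rotZL (-(α * s)))
        (heatExtension F (1 - Real.exp (-s)) ((Real.exp (-(s / 2)) • rotZL (α * s)) z))) y :=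
    (hasFDerivAt_freeResolvent hF h0 h1 α y).fderiv
  have key : (∫ s in Ioi (0:ℝ), lerayLin α (fun _ => 0) (fun z => (Real.exp (-(s / 2)) • rotZL (-(α * s)))
        (heatExtension F (1 - Real.exp (-s)) ((Real.exp (-(s / 2)) • rotZL (α * s)) z))) y) =
      α • ((∫ s in Ioi (0:ℝ), rotGenL ((Real.exp (-(s / 2)) • rotZL (-(α * s)))
          (heatExtension F (1 - Real.exp (-s)) ((Real.exp (-(s / 2)) • rotZL (α * s)) y)))) -
        ∫ s in Ioi (0:ℝ), fderiv ℝ (fun z => (Real.exp (-(s / 2)) • rotZL (-(α * s)))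
          (heatExtension F (1 - Real.exp (-s)) ((Real.exp (-(s / 2)) • rotZL (α * s)) z))) y (rotGenL y)) +
      (1/2:ℝ) • (∫ s in Ioi (0:ℝ), (Real.exp (-(s / 2)) • rotZL (-(α * s)))
          (heatExtension F (1 - Real.exp (-s)) ((Real.exp (-(s / 2)) • rotZL (α * s)) y))) +
      (1/2:ℝ) • (∫ s in Ioi (0:ℝ), fderiv ℝ (fun z => (Real.exp (-(s / 2)) • rotZL (-(α * s)))
          (heatExtension F (1 - Real.exp (-s)) ((Real.exp (-(s / 2)) • rotZL (α * s)) z))) y y) -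
      ∑ i : Fin 3, ∫ s in Ioi (0:ℝ), fderiv ℝ (fderiv ℝ (fun z => (Real.exp (-(s / 2)) • rotZL (-(α * s)))
          (heatExtension F (1 - Real.exp (-s)) ((Real.exp (-(s / 2)) • rotZL (α * s)) z)))) y
            (EuclideanSpace.basisFun (Fin 3) ℝ i) (EuclideanSpace.basisFun (Fin 3) ℝ i) := by
    have hint : (fun s : ℝ => lerayLin α (fun _ => 0) (fun z => (Real.exp (-(s / 2)) • rotZL (-(α * s)))
        (heatExtension F (1 - Real.exp (-s)) ((Real.exp (-(s / 2)) • rotZL (α * s)) z))) y) =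
      fun s => α • (rotGenL ((Real.exp (-(s / 2)) • rotZL (-(α * s)))
          (heatExtension F (1 - Real.exp (-s)) ((Real.exp (-(s / 2)) • rotZL (α * s)) y))) -
        fderiv ℝ (fun z => (Real.exp (-(s / 2)) • rotZL (-(α * s)))
          (heatExtension F (1 - Real.exp (-s)) ((Real.exp (-(s / 2)) • rotZL (α * s)) z))) y (rotGenL y)) +
      (1/2:ℝ) • (Real.exp (-(s / 2)) • rotZL (-(α * s)))
          (heatExtension F (1 - Real.exp (-s)) ((Real.exp (-(s / 2)) • rotZL (α * s)) y)) +
      (1/2:ℝ) • fderiv ℝ (fun z => (Real.exp (-(s / 2)) • rotZL (-(α * s)))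
          (heatExtension F (1 - Real.exp (-s)) ((Real.exp (-(s / 2)) • rotZL (α * s)) z))) y y -
      ∑ i : Fin 3, fderiv ℝ (fderiv ℝ (fun z => (Real.exp (-(s / 2)) • rotZL (-(α * s)))
          (heatExtension F (1 - Real.exp (-s)) ((Real.exp (-(s / 2)) • rotZL (α * s)) z)))) y
            (EuclideanSpace.basisFun (Fin 3) ℝ i) (EuclideanSpace.basisFun (Fin 3) ℝ i) :=
      funext fun s => lerayLin_zero_base_eq α _ y
    have hA1 : Integrable (fun s : ℝ => α • (rotGenL ((Real.exp (-(s / 2)) • rotZL (-(α * s)))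
          (heatExtension F (1 - Real.exp (-s)) ((Real.exp (-(s / 2)) • rotZL (α * s)) y))) -
        fderiv ℝ (fun z => (Real.exp (-(s / 2)) • rotZL (-(α * s)))
          (heatExtension F (1 - Real.exp (-s)) ((Real.exp (-(s / 2)) • rotZL (α * s)) z))) y (rotGenL y)))
        (volume.restrict (Ioi (0:ℝ))) := (hJV.sub (hDv (rotGenL y))).smul α
    have hA2 : Integrable (fun s : ℝ => (1/2:ℝ) • (Real.exp (-(s / 2)) • rotZL (-(α * s)))
          (heatExtension F (1 - Real.exp (-s)) ((Real.exp (-(s / 2)) • rotZL (α * s)) y)))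
        (volume.restrict (Ioi (0:ℝ))) := hV.smul (1/2:ℝ)
    have hA3 : Integrable (fun s : ℝ => (1/2:ℝ) • fderiv ℝ (fun z => (Real.exp (-(s / 2)) • rotZL (-(α * s)))
          (heatExtension F (1 - Real.exp (-s)) ((Real.exp (-(s / 2)) • rotZL (α * s)) z))) y y)
        (volume.restrict (Ioi (0:ℝ))) := (hDv y).smul (1/2:ℝ)
    have hA12 : Integrable (fun s : ℝ => α • (rotGenL ((Real.exp (-(s / 2)) • rotZL (-(α * s)))
          (heatExtension F (1 - Real.exp (-s)) ((Real.exp (-(s / 2)) • rotZL (α * s)) y))) -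
        fderiv ℝ (fun z => (Real.exp (-(s / 2)) • rotZL (-(α * s)))
          (heatExtension F (1 - Real.exp (-s)) ((Real.exp (-(s / 2)) • rotZL (α * s)) z))) y (rotGenL y)) +
      (1/2:ℝ) • (Real.exp (-(s / 2)) • rotZL (-(α * s)))
          (heatExtension F (1 - Real.exp (-s)) ((Real.exp (-(s / 2)) • rotZL (α * s)) y)))
        (volume.restrict (Ioi (0:ℝ))) := hA1.add hA2
    have hA123 : Integrable (fun s : ℝ => α • (rotGenL ((Real.exp (-(s / 2)) • rotZL (-(α * s)))
          (heatExtension F (1 - Real.exp (-s)) ((Real.exp (-(s / 2)) • rotZL (α * s)) y))) -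
        fderiv ℝ (fun z => (Real.exp (-(s / 2)) • rotZL (-(α * s)))
          (heatExtension F (1 - Real.exp (-s)) ((Real.exp (-(s / 2)) • rotZL (α * s)) z))) y (rotGenL y)) +
      (1/2:ℝ) • (Real.exp (-(s / 2)) • rotZL (-(α * s)))
          (heatExtension F (1 - Real.exp (-s)) ((Real.exp (-(s / 2)) • rotZL (α * s)) y)) +
      (1/2:ℝ) • fderiv ℝ (fun z => (Real.exp (-(s / 2)) • rotZL (-(α * s)))
          (heatExtension F (1 - Real.exp (-s)) ((Real.exp (-(s / 2)) • rotZL (α * s)) z))) y y)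
        (volume.restrict (Ioi (0:ℝ))) := hA12.add hA3
    rw [hint, integral_sub hA123 hΔ, integral_add hA12 hA3, integral_add hA1 hA2,
      integral_smul, integral_smul, integral_smul, integral_sub hJV (hDv (rotGenL y)),
      integral_finsetSum _ (fun i _ => hD2i i)]
  have hsum : ∑ i : Fin 3, fderiv ℝ (fderiv ℝ (fun y => ∫ s in Ioi (0:ℝ), (Real.exp (-(s / 2)) • rotZL (-(α * s)))
        (heatExtension F (1 - Real.exp (-s)) ((Real.exp (-(s / 2)) • rotZL (α * s)) y)))) y
        (EuclideanSpace.basisFun (Fin 3) ℝ i) (EuclideanSpace.basisFun (Fin 3) ℝ i) =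
      ∑ i : Fin 3, ∫ s in Ioi (0:ℝ), fderiv ℝ (fderiv ℝ (fun z => (Real.exp (-(s / 2)) • rotZL (-(α * s)))
        (heatExtension F (1 - Real.exp (-s)) ((Real.exp (-(s / 2)) • rotZL (α * s)) z)))) y
          (EuclideanSpace.basisFun (Fin 3) ℝ i) (EuclideanSpace.basisFun (Fin 3) ℝ i) :=
    Finset.sum_congr rfl fun i _ => hD2apply i
  rw [key, lerayLin_zero_base_eq, hsum, hD1y, ContinuousLinearMap.integral_apply hD, ContinuousLinearMap.integral_apply hD,
    ← rotGenL.integral_comp_comm hV]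

/-- **The free resolvent solves `𝓛_(α,0) W = F`** (for `F ∈ C¹` bounded with bounded derivative, every rate `α`). -/
theorem lerayLin_freeResolvent_eq (hF : ContDiff ℝ 1 F) (h0 : ∀ z, ‖F z‖ ≤ C₀) (h1 : ∀ z, ‖fderiv ℝ F z‖ ≤ C₁)
    (α : ℝ) (y : EuclideanSpace ℝ (Fin 3)) :
    lerayLin α (fun _ => 0) (fun y => ∫ s in Ioi (0:ℝ), (Real.exp (-(s / 2)) • rotZL (-(α * s)))
        (heatExtension F (1 - Real.exp (-s)) ((Real.exp (-(s / 2)) • rotZL (α * s)) y))) y = F y := by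
  rw [lerayLin_freeResolvent hF h0 h1 α y, integral_lerayLin_freeSlice hF h0 h1 α y]

end Equation

/-! ## The free gate, velocity part -/

/-- From a Y-bound: `F ∈ C¹`, `‖F‖ ≤ R`, `‖DF‖ ≤ R` and the two quadratic weights. -/
theorem YBound.unpack {F : EuclideanSpace ℝ (Fin 3) → EuclideanSpace ℝ (Fin 3)} {R : ℝ} (h : YBound F R) :
    ContDiff ℝ 1 F ∧ (∀ z, ‖F z‖ ≤ R) ∧ (∀ z, ‖fderiv ℝ F z‖ ≤ R) ∧
      (∀ z, (1 + ‖z‖) ^ 2 * ‖F z‖ ≤ R) ∧ (∀ z, (1 + ‖z‖) ^ 2 * ‖fderiv ℝ F z‖ ≤ R) := by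
  refine ⟨h.1, fun z => ?_, fun z => ?_, fun z => (h.2 z).1, fun z => (h.2 z).2⟩
  · have h1 : 1 ≤ (1 + ‖z‖) ^ 2 := one_le_pow₀ (by linarith [norm_nonneg z])
    have := (h.2 z).1
    nlinarith [norm_nonneg (F z)]
  · have h1 : 1 ≤ (1 + ‖z‖) ^ 2 := one_le_pow₀ (by linarith [norm_nonneg z])
    have := (h.2 z).2
    nlinarith [norm_nonneg (fderiv ℝ F z)]

/-- **THE FREE RESOLVENT (free Kelvin gate, velocity part).**  There is an absolute constant `C ≥ 0` such that for
every rate `α` and every forcing `F` in the Y-scale, `YBound F R`, the field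
`W(y) = ∫₀^∞ (e^{-s/2} R_{−αs}) (e^{(1 − e^{-s})Δ} F)(e^{-s/2} R_{αs} y) ds` lies in the X-scale with `XBound W (C R)` and
solves the free linearised profile equation `𝓛_(α,0) W = F` pointwise.  (Existence half of the free gate; with
`…KelvinGateFreeKernel` the free operator is a bijection between the divergence-free parts of the two scales up to the
pressure.) -/
theorem free_resolvent :
    ∃ C : ℝ, 0 ≤ C ∧ ∀ (α : ℝ) (F : EuclideanSpace ℝ (Fin 3) → EuclideanSpace ℝ (Fin 3)) (R : ℝ), YBound F R →
      XBound (fun y => ∫ s in Ioi (0:ℝ), (Real.exp (-(s / 2)) • rotZL (-(α * s)))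
          (heatExtension F (1 - Real.exp (-s)) ((Real.exp (-(s / 2)) • rotZL (α * s)) y))) (C * R) ∧
        ∀ y, lerayLin α (fun _ => 0) (fun y => ∫ s in Ioi (0:ℝ), (Real.exp (-(s / 2)) • rotZL (-(α * s)))
          (heatExtension F (1 - Real.exp (-s)) ((Real.exp (-(s / 2)) • rotZL (α * s)) y))) y = F y := by
  obtain ⟨C_G, hCG, hG, hG'⟩ := sq_weight_fderiv_heatExtension_le
  set I : ℝ := ∫ s in Ioi (0:ℝ), s ^ (-(1 / 2 : ℝ)) * exp (-(s / 2)) with hI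
  have hI0 : 0 ≤ I := setIntegral_nonneg measurableSet_Ioi fun s hs => by
    have : 0 < s := hs
    positivity
  refine ⟨4 * C_G + 4 * C_G + 5 * (2 : ℝ) ^ ((3 : ℝ) / 2) * C_G * I, by positivity, ?_⟩
  intro α F R hY
  obtain ⟨hF, h0, h1, hA, hA'⟩ := hY.unpack
  have hR : 0 ≤ R := hY.nonneg
  have hK0 : 0 ≤ 5 * (2 : ℝ) ^ ((3 : ℝ) / 2) * C_G * I := by positivity
  have hc1 : 4 * C_G ≤ 4 * C_G + 4 * C_G + 5 * (2 : ℝ) ^ ((3 : ℝ) / 2) * C_G * I := by nlinarith [hCG.le]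
  have hc3 : 5 * (2 : ℝ) ^ ((3 : ℝ) / 2) * C_G * I ≤ 4 * C_G + 4 * C_G + 5 * (2 : ℝ) ^ ((3 : ℝ) / 2) * C_G * I := by
    nlinarith [hCG.le]
  refine ⟨⟨contDiff_two_freeResolvent hF h0 h1 α, fun y => ⟨?_, ?_, ?_⟩⟩, fun y => lerayLin_freeResolvent_eq hF h0 h1 α y⟩
  · -- value
    have h := weight_norm_freeResolvent_le hCG.le (fun t ht f hf A hfA x => hG ht hf hfA x) hF.continuous hA α y
    calc _ ≤ 4 * C_G * R := h
      _ ≤ (4 * C_G + 4 * C_G + 5 * (2 : ℝ) ^ ((3 : ℝ) / 2) * C_G * I) * R := mul_le_mul_of_nonneg_right hc1 hR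
  · -- first derivative
    rw [(hasFDerivAt_freeResolvent hF h0 h1 α y).fderiv]
    have h := weight_norm_fderiv_freeResolvent_le hCG.le (fun t ht f hf A hfA x => hG ht hf hfA x) hF h0 hA' α y
    calc _ ≤ 4 * C_G * R := h
      _ ≤ (4 * C_G + 4 * C_G + 5 * (2 : ℝ) ^ ((3 : ℝ) / 2) * C_G * I) * R := mul_le_mul_of_nonneg_right hc1 hR
  · -- second derivative
    have hD1 : fderiv ℝ (fun y => ∫ s in Ioi (0:ℝ), (Real.exp (-(s / 2)) • rotZL (-(α * s)))
          (heatExtension F (1 - Real.exp (-s)) ((Real.exp (-(s / 2)) • rotZL (α * s)) y))) =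
        fun y => ∫ s in Ioi (0:ℝ), fderiv ℝ (fun z => (Real.exp (-(s / 2)) • rotZL (-(α * s)))
          (heatExtension F (1 - Real.exp (-s)) ((Real.exp (-(s / 2)) • rotZL (α * s)) z))) y :=
      funext fun y => (hasFDerivAt_freeResolvent hF h0 h1 α y).fderiv
    rw [← norm_iteratedFDeriv_fderiv, norm_iteratedFDeriv_one, hD1, (hasFDerivAt_fderiv_freeResolvent hF h0 h1 α y).fderiv]
    have h := weight_norm_fderiv_fderiv_freeResolvent_le hCG.le (fun t ht f hf A hfA x => hG' ht hf hfA x) hF h0 hA' α y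
    calc _ ≤ 5 * (2 : ℝ) ^ ((3 : ℝ) / 2) * C_G * R * I := h
      _ = (5 * (2 : ℝ) ^ ((3 : ℝ) / 2) * C_G * I) * R := by ring
      _ ≤ (4 * C_G + 4 * C_G + 5 * (2 : ℝ) ^ ((3 : ℝ) / 2) * C_G * I) * R := mul_le_mul_of_nonneg_right hc3 hR

end Summit.NavierStokesRegularity.NavierStokesRegularity.Theorems.KelvinGate

end
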